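import Summits.AtomisticToContinuum.Crystallization.Theorems.CoarseGrains.Negative.PredicateAPI
import Summits.AtomisticToContinuum.Crystallization.Theorems.ExcessDecayLiouvilleFarField
import Literature.MathematicalPhysics.StatisticalMechanics.LennardJonesClusters
import Mathlib.MeasureTheory.Measure.Lebesgue.EqHaar

/-!
# Line `Sketch` (crux `FineGrains`, stmt-AtomisticToContinuum-9330): hereditary slack

Stub `stub_flatComparison` of the line skeleton `Sketch` (statement `FlatComparison` verbatim):
every ball `B_R(c)` (`R ≥ 1`) of a `δ`-separated Lennard-Jones ground state `x` is a
`C(δ) R²`-almost-minimiser of its own particle number against arbitrary injective competitor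
patches `y'` of at most as many particles in `B_{R-1}(c)`.  Proof: with `S` the particles in the
ball, `2 E(x) = 2 E(x|S) + 2 E(x|Sᶜ) + 2 X`, `X = Σ_{S × Sᶜ} V_LJ` (`sum_sum_eq_add_compl`); the
competitor `x|Sᶜ ++ y'` (cross distances `≥ 1`, where `V_LJ ≤ 0`), padded with far-away parked
particles (`groundStateEnergy_le_interactionEnergy_of_le`), gives `E(x) ≤ E(x|Sᶜ) + E(y')`, so
`E(x|S) ≤ E(y') − X ≤ E(y') + (1/6) Σ_{S × Sᶜ} |x_j − x_l|⁻⁶`.  The analytic input is the surface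
bound `Σ_{S × Sᶜ} |x_j − x_l|⁻⁶ ≤ C(δ) R²` (`exists_crossSum_le`): a particle at depth `s` sees the
exterior at distances `≥ max(δ, s)` (inner sum `≤ 1024 δ⁻³ max(δ,s)⁻³` by
`sum_inv_pow_le_of_separated`), the depth shell `⌊s⌋ = k` holds `≤ 24(1+δ)(R+δ/2)²/δ³` separated
points (disjoint `δ/2`-balls in an annulus, `card_mul_pow_add_pow_le_of_separated`,
`card_shell_le`), and `Σ_k max(δ,k)⁻³ ≤ δ⁻³ + 2`.  All `[folklore]`.
-/

noncomputable section

namespace Summit.AtomisticToContinuum.Crystallization.Theorems.ExcessDecayLiouvilleFineGrains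

open scoped BigOperators ENNReal
open Metric Set Module MeasureTheory
open Literature.MathematicalPhysics.StatisticalMechanics
open Summit.AtomisticToContinuum.Crystallization.Theorems.ExcessDecayLiouville
open Summit.AtomisticToContinuum.Crystallization.Theorems.CoarseGrains.Negative.PredicateAPI

open scoped Function in
/-- **Annulus packing by volume.** In an `n`-dimensional real normed space, `r`-separated points
of the annulus `a < dist · p ≤ b` (`0 < r`, `r/2 ≤ a ≤ b`) satisfy
`#s · (r/2)ⁿ + (a − r/2)ⁿ ≤ (b + r/2)ⁿ`: the `r/2`-balls about them are disjoint, disjoint from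
`closedBall p (a − r/2)`, and contained with it in `ball p (b + r/2)`. [folklore] -/
theorem card_mul_pow_add_pow_le_of_separated {E : Type*} [NormedAddCommGroup E]
    [NormedSpace ℝ E] [FiniteDimensional ℝ E] (s : Finset E) (p : E) {r a b : ℝ} (hr : 0 < r)
    (ha : r / 2 ≤ a) (hab : a ≤ b) (hs : ∀ c ∈ s, a < dist c p ∧ dist c p ≤ b)
    (h : ∀ c ∈ s, ∀ d ∈ s, c ≠ d → r ≤ dist c d) :
    (s.card : ℝ) * (r / 2) ^ finrank ℝ E + (a - r / 2) ^ finrank ℝ E ≤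
      (b + r / 2) ^ finrank ℝ E := by
  borelize E
  let μ : Measure E := Measure.addHaar
  have ρpos : 0 < b + r / 2 := by linarith
  have ρ'nn : 0 ≤ a - r / 2 := by linarith
  set A := ⋃ c ∈ s, ball (c : E) (r / 2) with hA
  have D : Set.Pairwise (s : Set E) (Disjoint on fun c => ball (c : E) (r / 2)) := by
    rintro c hc d hd hcd
    apply ball_disjoint_ball
    linarith [h c hc d hd hcd]
  have A_disj : Disjoint A (closedBall p (a - r / 2)) := by
    rw [hA, Set.disjoint_iUnion₂_left]
    refine fun c hc => Set.disjoint_left.2 fun z hz hz' => ?_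
    rw [mem_ball] at hz
    rw [mem_closedBall] at hz'
    linarith [(hs c hc).1, dist_triangle c z p, dist_comm c z]
  have U_subset : A ∪ closedBall p (a - r / 2) ⊆ ball p (b + r / 2) := by
    refine Set.union_subset (iUnion₂_subset fun x hx => ?_) (closedBall_subset_ball (by linarith))
    exact ball_subset_ball' (by linarith [(hs x hx).2])
  have hμA : μ A = (s.card : ℝ≥0∞) * (ENNReal.ofReal ((r / 2) ^ finrank ℝ E) * μ (ball 0 1)) := by
    rw [hA, measure_biUnion_finset D fun c _ => measurableSet_ball]
    simp only [μ.addHaar_ball_of_pos _ (half_pos hr), Finset.sum_const, nsmul_eq_mul]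
  have I : ((s.card : ℝ≥0∞) * ENNReal.ofReal ((r / 2) ^ finrank ℝ E) +
      ENNReal.ofReal ((a - r / 2) ^ finrank ℝ E)) * μ (ball 0 1) ≤
      ENNReal.ofReal ((b + r / 2) ^ finrank ℝ E) * μ (ball 0 1) :=
    calc ((s.card : ℝ≥0∞) * ENNReal.ofReal ((r / 2) ^ finrank ℝ E) +
          ENNReal.ofReal ((a - r / 2) ^ finrank ℝ E)) * μ (ball 0 1)
        = μ A + μ (closedBall p (a - r / 2)) := by rw [hμA, μ.addHaar_closedBall _ ρ'nn]; ring
      _ = μ (A ∪ closedBall p (a - r / 2)) :=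
          (measure_union A_disj measurableSet_closedBall).symm
      _ ≤ μ (ball p (b + r / 2)) := measure_mono U_subset
      _ = ENNReal.ofReal ((b + r / 2) ^ finrank ℝ E) * μ (ball 0 1) :=
          μ.addHaar_ball_of_pos _ ρpos
  have J := (ENNReal.mul_le_mul_iff_left (measure_ball_pos μ _ zero_lt_one).ne'
    measure_ball_lt_top.ne).1 I
  rw [← ENNReal.ofReal_natCast, ← ENNReal.ofReal_mul (by positivity),
    ← ENNReal.ofReal_add (by positivity) (by positivity)] at J
  exact (ENNReal.ofReal_le_ofReal_iff (by positivity)).1 J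

/-- **Shell count in `ℝ³`.** A `δ`-separated finite subset of the spherical shell
`b − 1 < dist · p ≤ b` (`b ≥ 0`) of `ℝ³` has at most `24 (1 + δ) (b + δ/2)² / δ³` points (annulus
packing if `b − 1 ≥ δ/2`, ball packing `card_le_of_separated_of_dist_le` otherwise). [folklore] -/
theorem card_shell_le (s : Finset (EuclideanSpace ℝ (Fin 3))) (p : EuclideanSpace ℝ (Fin 3))
    {δ b : ℝ} (hδ : 0 < δ) (hb : 0 ≤ b) (hs : ∀ c ∈ s, b - 1 < dist c p ∧ dist c p ≤ b)
    (h : ∀ c ∈ s, ∀ d ∈ s, c ≠ d → δ ≤ dist c d) :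
    (s.card : ℝ) ≤ 24 * (1 + δ) * (b + δ / 2) ^ 2 / δ ^ 3 := by
  have hfin : finrank ℝ (EuclideanSpace ℝ (Fin 3)) = 3 := finrank_euclideanSpace_fin
  rw [le_div_iff₀ (by positivity)]
  by_cases hcase : δ / 2 ≤ b - 1
  · have key := card_mul_pow_add_pow_le_of_separated s p hδ hcase (by linarith) hs h
    rw [hfin] at key
    have h0 : 0 ≤ b - 1 - δ / 2 := by linarith
    have e : (b + δ / 2) ^ 3 - (b - 1 - δ / 2) ^ 3 =
        (1 + δ) * ((b + δ / 2) ^ 2 + (b + δ / 2) * (b - 1 - δ / 2) + (b - 1 - δ / 2) ^ 2) := by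
      ring
    have f : (b + δ / 2) * (b - 1 - δ / 2) ≤ (b + δ / 2) ^ 2 := by nlinarith
    have g : (b - 1 - δ / 2) ^ 2 ≤ (b + δ / 2) ^ 2 := by nlinarith
    have k3 : (s.card : ℝ) * (δ / 2) ^ 3 ≤ 3 * (1 + δ) * (b + δ / 2) ^ 2 := by nlinarith
    have e8 : (s.card : ℝ) * δ ^ 3 = 8 * ((s.card : ℝ) * (δ / 2) ^ 3) := by ring
    rw [e8]
    linarith
  · push Not at hcase
    have key := card_le_of_separated_of_dist_le s p hδ hb (fun c hc => (hs c hc).2) h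
    have e : 2 * b / δ + 1 = 2 * (b + δ / 2) / δ := by
      field_simp
    rw [hfin, e, div_pow, le_div_iff₀ (by positivity)] at key
    have hu0 : 0 ≤ b + δ / 2 := by positivity
    calc (s.card : ℝ) * δ ^ 3 ≤ (2 * (b + δ / 2)) ^ 3 := key
      _ = 8 * (b + δ / 2) * (b + δ / 2) ^ 2 := by ring
      _ ≤ 24 * (1 + δ) * (b + δ / 2) ^ 2 := mul_le_mul_of_nonneg_right (by linarith) (sq_nonneg _)

/-- **Boundary cross sum of a separated set is a surface term.** For every `δ > 0` there is `C`
such that for every injective `δ`-separated configuration `x` in `ℝ³`, centre `c`, radius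
`R ≥ 1` and the index set `S` of the particles in `closedBall c R`:
`Σ_{j ∈ S} Σ_{l ∉ S} |x_j − x_l|⁻⁶ ≤ C R²` (inner sums by `sum_inv_pow_le_of_separated` at radius
`max(δ, ⌊depth⌋)`, depth shells counted by `card_shell_le`, `Σ_k max(δ,k)⁻³ ≤ δ⁻³ + 2`).
[folklore] -/
theorem exists_crossSum_le (δ : ℝ) (hδ : 0 < δ) : ∃ C : ℝ,
    ∀ (N : ℕ) (x : Fin N → EuclideanSpace ℝ (Fin 3)), Function.Injective x →
      (∀ i j : Fin N, i ≠ j → δ ≤ dist (x i) (x j)) →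
      ∀ (c : EuclideanSpace ℝ (Fin 3)) (R : ℝ), 1 ≤ R → ∀ S : Finset (Fin N),
        (∀ j : Fin N, j ∈ S ↔ dist (x j) c ≤ R) →
        ∑ j ∈ S, ∑ l ∈ Sᶜ, (dist (x j) (x l))⁻¹ ^ 6 ≤ C * R ^ 2 := by
  refine ⟨24 * (1 + δ) * (1 + δ / 2) ^ 2 / δ ^ 3 * (1024 / δ ^ 3 * ((δ⁻¹) ^ 3 + 2)), ?_⟩
  intro N x hx hsep c R hR S hS
  have hxsep : ∀ (F : Finset (Fin N)), ∀ a ∈ F.image x, ∀ b ∈ F.image x, a ≠ b → δ ≤ dist a b := by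
    intro F a ha b hb hab
    obtain ⟨l, -, rfl⟩ := Finset.mem_image.1 ha
    obtain ⟨l', -, rfl⟩ := Finset.mem_image.1 hb
    exact hsep l l' fun h => hab (h ▸ rfl)
  -- depth shells `⌊R - |x_j - c|⌋ = k`
  set m : Fin N → ℕ := fun j => ⌊R - dist (x j) c⌋₊ with hm
  have hfloor : ∀ j ∈ S, ((m j : ℕ) : ℝ) ≤ R - dist (x j) c ∧ R - dist (x j) c < (m j : ℕ) + 1 :=
    fun j hj => ⟨Nat.floor_le (by linarith [(hS j).1 hj]), Nat.lt_floor_add_one _⟩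
  -- (1) the inner sums
  have inner : ∀ j ∈ S, ∑ l ∈ Sᶜ, (dist (x j) (x l))⁻¹ ^ 6 ≤
      1024 / (δ ^ 3 * (max δ (m j : ℝ)) ^ 3) := by
    intro j hj
    have hjR : dist (x j) c ≤ R := (hS j).1 hj
    have hsum : ∑ l ∈ Sᶜ, (dist (x j) (x l))⁻¹ ^ 6 =
        ∑ a ∈ Sᶜ.image x, (dist a (x j))⁻¹ ^ (3 + 3) := by
      rw [Finset.sum_image fun l _ l' _ hl => hx hl]
      exact Finset.sum_congr rfl fun l _ => by rw [dist_comm]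
    rw [hsum]
    refine sum_inv_pow_le_of_separated (Sᶜ.image x) (x j) (k := 3) (by norm_num) hδ
      (le_max_left _ _) (hxsep _) fun a ha => ?_
    obtain ⟨l, hl, rfl⟩ := Finset.mem_image.1 ha
    have hlR : ¬ dist (x l) c ≤ R := fun h => Finset.mem_compl.1 hl ((hS l).2 h)
    refine max_le (hsep l j fun h => hlR (h ▸ hjR)) ?_
    push Not at hlR
    linarith [dist_triangle (x l) (x j) c, (hfloor j hj).1]
  -- (2) regroup by shells and count each shell
  set t := S.image m with ht
  have hmaps : ∀ j ∈ S, m j ∈ t := fun j hj => Finset.mem_image_of_mem m hj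
  have step2 : ∑ j ∈ S, 1024 / (δ ^ 3 * (max δ (m j : ℝ)) ^ 3) = ∑ k ∈ t,
      ((S.filter fun j => m j = k).card : ℝ) * (1024 / (δ ^ 3 * (max δ (k : ℝ)) ^ 3)) := by
    have := Finset.sum_fiberwise_of_maps_to' hmaps
      (f := fun k : ℕ => 1024 / (δ ^ 3 * (max δ (k : ℝ)) ^ 3))
    simp only [Finset.sum_const, nsmul_eq_mul] at this
    exact this.symm
  have step3 : ∀ k ∈ t, ((S.filter fun j => m j = k).card : ℝ) ≤
      24 * (1 + δ) * (R + δ / 2) ^ 2 / δ ^ 3 := by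
    intro k hk
    obtain ⟨j₀, hj₀, hj₀k⟩ := Finset.mem_image.1 hk
    have hkR : (k : ℝ) ≤ R := by
      have h1 := (hfloor j₀ hj₀).1
      rw [hj₀k] at h1
      linarith [dist_nonneg (x := x j₀) (y := c)]
    rw [← Finset.card_image_of_injOn (hx.injOn (s := ((S.filter fun j => m j = k) : Set _)))]
    have := card_shell_le ((S.filter fun j => m j = k).image x) c hδ (b := R - k) (by linarith)
      ?_ (hxsep _)
    · refine this.trans ?_
      rw [div_le_div_iff_of_pos_right (by positivity)]
      exact mul_le_mul_of_nonneg_left (pow_le_pow_left₀ (by linarith)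
        (by linarith [(Nat.cast_nonneg k : (0 : ℝ) ≤ k)]) 2) (by positivity)
    · intro a ha
      obtain ⟨j, hj, rfl⟩ := Finset.mem_image.1 ha
      obtain ⟨hjS, hjk⟩ := Finset.mem_filter.1 hj
      obtain ⟨h1, h2⟩ := hfloor j hjS
      rw [hjk] at h1 h2
      constructor <;> linarith
  -- (3) `Σ_k max(δ,k)⁻³ ≤ δ⁻³ + 2`
  have step4 : ∑ k ∈ t, 1024 / (δ ^ 3 * (max δ (k : ℝ)) ^ 3) ≤
      1024 / δ ^ 3 * ((δ⁻¹) ^ 3 + 2) := by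
    have hw : ∀ k : ℕ, 1024 / (δ ^ 3 * (max δ (k : ℝ)) ^ 3) =
        1024 / δ ^ 3 * ((max δ (k : ℝ))⁻¹) ^ 3 := fun k => by
      rw [inv_pow, div_mul_eq_div_div, div_eq_mul_inv (1024 / δ ^ 3)]
    simp only [hw, ← Finset.mul_sum]
    refine mul_le_mul_of_nonneg_left ?_ (by positivity)
    have hsub : t ⊆ insert 0 (Finset.Ioo 0 (t.sup id + 1)) := by
      intro k hk
      rw [Finset.mem_insert, Finset.mem_Ioo]
      rcases Nat.eq_zero_or_pos k with h | h
      · exact Or.inl h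
      · exact Or.inr ⟨h, Nat.lt_succ_of_le (Finset.le_sup (f := id) hk)⟩
    have hIoo : ∀ k ∈ Finset.Ioo 0 (t.sup id + 1),
        ((max δ (k : ℝ))⁻¹) ^ 3 ≤ ((k : ℝ) ^ 2)⁻¹ := by
      intro k hk
      have hk1 : (1 : ℝ) ≤ k := by exact_mod_cast (Finset.mem_Ioo.1 hk).1
      calc ((max δ (k : ℝ))⁻¹) ^ 3 ≤ ((k : ℝ)⁻¹) ^ 3 :=
            pow_le_pow_left₀ (by positivity) (inv_anti₀ (by linarith) (le_max_right _ _)) 3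
        _ ≤ ((k : ℝ)⁻¹) ^ 2 :=
            pow_le_pow_of_le_one (by positivity) (inv_le_one_of_one_le₀ hk1) (by norm_num)
        _ = ((k : ℝ) ^ 2)⁻¹ := by rw [inv_pow]
    have hmax0 : ((max δ ((0 : ℕ) : ℝ))⁻¹) ^ 3 ≤ (δ⁻¹) ^ 3 :=
      pow_le_pow_left₀ (inv_nonneg.2 (hδ.le.trans (le_max_left _ _)))
        (inv_anti₀ hδ (le_max_left _ _)) 3
    have h2 : ∑ k ∈ Finset.Ioo 0 (t.sup id + 1), ((k : ℝ) ^ 2)⁻¹ ≤ 2 := by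
      simpa using sum_Ioo_inv_sq_le (α := ℝ) 0 (t.sup id + 1)
    calc ∑ k ∈ t, ((max δ (k : ℝ))⁻¹) ^ 3
        ≤ ∑ k ∈ insert 0 (Finset.Ioo 0 (t.sup id + 1)), ((max δ (k : ℝ))⁻¹) ^ 3 :=
          Finset.sum_le_sum_of_subset_of_nonneg hsub fun k _ _ => by positivity
      _ = ((max δ ((0 : ℕ) : ℝ))⁻¹) ^ 3 +
            ∑ k ∈ Finset.Ioo 0 (t.sup id + 1), ((max δ (k : ℝ))⁻¹) ^ 3 :=
          Finset.sum_insert (by simp)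
      _ ≤ (δ⁻¹) ^ 3 + ∑ k ∈ Finset.Ioo 0 (t.sup id + 1), ((k : ℝ) ^ 2)⁻¹ :=
          add_le_add hmax0 (Finset.sum_le_sum hIoo)
      _ ≤ (δ⁻¹) ^ 3 + 2 := by linarith
  -- (4) assembly
  have hR2 : (R + δ / 2) ^ 2 ≤ (1 + δ / 2) ^ 2 * R ^ 2 := by
    rw [← mul_pow]
    exact pow_le_pow_left₀ (by positivity) (by nlinarith) 2
  calc ∑ j ∈ S, ∑ l ∈ Sᶜ, (dist (x j) (x l))⁻¹ ^ 6
      ≤ ∑ j ∈ S, 1024 / (δ ^ 3 * (max δ (m j : ℝ)) ^ 3) := Finset.sum_le_sum inner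
    _ = ∑ k ∈ t, ((S.filter fun j => m j = k).card : ℝ) *
          (1024 / (δ ^ 3 * (max δ (k : ℝ)) ^ 3)) := step2
    _ ≤ ∑ k ∈ t, (24 * (1 + δ) * (R + δ / 2) ^ 2 / δ ^ 3) *
          (1024 / (δ ^ 3 * (max δ (k : ℝ)) ^ 3)) :=
        Finset.sum_le_sum fun k hk => mul_le_mul_of_nonneg_right (step3 k hk) (by positivity)
    _ ≤ (24 * (1 + δ) * (R + δ / 2) ^ 2 / δ ^ 3) * (1024 / δ ^ 3 * ((δ⁻¹) ^ 3 + 2)) := by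
        rw [← Finset.mul_sum]
        exact mul_le_mul_of_nonneg_left step4 (by positivity)
    _ ≤ (24 * (1 + δ) * ((1 + δ / 2) ^ 2 * R ^ 2) / δ ^ 3) * (1024 / δ ^ 3 * ((δ⁻¹) ^ 3 + 2)) := by
        gcongr
    _ = _ := by ring

/-! ### The comparison -/

/-- The attractive tail of the Lennard-Jones potential: `V_LJ(r) ≥ −r⁻⁶/6` for every `r`
(the repulsive part `r⁻¹²/12` is non-negative). [folklore] -/
theorem neg_inv_pow_six_le_lennardJones (r : ℝ) : -((1 / 6) * (r⁻¹) ^ 6) ≤ lennardJones r := by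
  unfold lennardJones
  have h : 0 ≤ (r⁻¹) ^ 12 := by positivity
  linarith

/-- **Monotonicity of `E(N)` by parking particles far away.** For Lennard-Jones in dimension
`d ≥ 1`, `E(M) ≤ 𝓔(w)` for every configuration `w` of `K ≤ M` distinct points: append, one at a
time, a particle at distance `≥ 1` from all the others, where `V_LJ ≤ 0`. [folklore] -/
theorem groundStateEnergy_le_interactionEnergy_of_le {d K M : ℕ} (hd : 0 < d) (hKM : K ≤ M)
    {w : Fin K → EuclideanSpace ℝ (Fin d)} (hw : Function.Injective w) :
    groundStateEnergy lennardJones d M ≤ interactionEnergy lennardJones w := by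
  obtain ⟨J, rfl⟩ := Nat.exists_eq_add_of_le hKM
  clear hKM
  induction J generalizing K w hw with
  | zero => exact groundStateEnergy_lennardJones_le hw
  | succ J ih =>
    -- one far particle `q`
    have hT0 : (0 : ℝ) ≤ 1 + ∑ i, ‖w i‖ :=
      add_nonneg zero_le_one (Finset.sum_nonneg fun i _ => norm_nonneg (w i))
    set q : EuclideanSpace ℝ (Fin d) := EuclideanSpace.single (⟨0, hd⟩ : Fin d) (1 + ∑ i, ‖w i‖)
      with hq
    have hqn : ‖q‖ = 1 + ∑ i, ‖w i‖ := by simp [hq, abs_of_nonneg hT0]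
    have hfar : ∀ i, 1 ≤ dist (w i) q := fun i => by
      have h1 : ‖w i‖ ≤ ∑ l, ‖w l‖ :=
        Finset.single_le_sum (f := fun l => ‖w l‖) (fun l _ => norm_nonneg _) (Finset.mem_univ i)
      have h2 : ‖q‖ - ‖w i‖ ≤ dist (w i) q := by
        rw [dist_comm, dist_eq_norm]
        exact norm_sub_norm_le _ _
      linarith
    have hne : ∀ i (k : Fin 1), w i ≠ (fun _ => q) k := fun i _ h => by
      have := hfar i
      rw [h, dist_self] at this
      norm_num at this
    have hinj : Function.Injective (Fin.append w fun _ : Fin 1 => q) :=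
      Fin.append_injective_iff.2 ⟨hw, Function.injective_of_subsingleton _, hne⟩
    have h := ih hinj
    rw [interactionEnergy_append lennardJones lennardJones_zero,
      interactionEnergy_of_subsingleton lennardJones (fun _ : Fin 1 => q), add_zero] at h
    have hcross : ∑ i, ∑ k : Fin 1, lennardJones (dist (w i) ((fun _ => q) k)) ≤ 0 :=
      Finset.sum_nonpos fun i _ => Finset.sum_nonpos fun k _ => lennardJones_nonpos (hfar i)
    rw [show K + (J + 1) = K + 1 + J by omega]
    linarith

/-- **Hereditary slack of ground-state balls** (stub `stub_flatComparison` of line `Sketch`, crux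
`FineGrains`; statement `FlatComparison` verbatim).  For every `δ > 0` there is `C` such that for
every `δ`-separated Lennard-Jones ground state `x` in `ℝ³`, every ball `B_R(c)` with `R ≥ 1`,
every injective enumeration `y` of `range x ∩ B_R(c)` and every injective competitor patch `y'`
of at most as many particles in `B_{R-1}(c)`: `E(y) ≤ E(y') + C R²` (minimality against the
competitor "exterior kept, patch inside, surplus parked far away"; the slack is the attractive
cross interaction across the sphere, a surface term by `exists_crossSum_le`). [folklore] -/
theorem stub_flatComparison :
    ∀ δ : ℝ, 0 < δ → ∃ C : ℝ, ∀ (N : ℕ) (x : Fin N → E3), IsGroundState lennardJones x →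
    (∀ i j : Fin N, i ≠ j → δ ≤ dist (x i) (x j)) →
    ∀ (c : E3) (R : ℝ), 1 ≤ R → ∀ (n : ℕ) (y : Fin n → E3), Function.Injective y →
      (∀ p : E3, p ∈ Set.range y ↔ p ∈ Set.range x ∧ dist p c ≤ R) →
      ∀ (n' : ℕ) (y' : Fin n' → E3), n' ≤ n → Function.Injective y' →
        (∀ i : Fin n', dist (y' i) c ≤ R - 1) →
        interactionEnergy lennardJones y ≤ interactionEnergy lennardJones y' + C * R ^ 2 := by
  intro δ hδ
  obtain ⟨C₁, hcross⟩ := exists_crossSum_le δ hδ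
  refine ⟨C₁ / 6, ?_⟩
  intro N x hx hsep c R hR n y hy hrange n' y' hn' hy' hy'R
  set S : Finset (Fin N) := Finset.univ.filter fun j => dist (x j) c ≤ R with hS
  have hSiff : ∀ j : Fin N, j ∈ S ↔ dist (x j) c ≤ R := fun j => by simp [hS]
  have hbound := hcross N x hx.1 hsep c R hR S hSiff
  -- (1) `y` re-indexes `x|S`
  have hmem : ∀ i : Fin n, ∃ j : Fin N, x j = y i := fun i => ((hrange (y i)).1 ⟨i, rfl⟩).1
  choose f hf using hmem
  let fe : Fin n ↪ Fin N := ⟨f, fun i i' h => hy (by rw [← hf i, ← hf i', h])⟩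
  have hfe : ∀ i, fe i = f i := fun i => rfl
  have hmapS : Finset.univ.map fe = S := by
    ext j
    simp only [Finset.mem_map, Finset.mem_univ, true_and, hSiff, hfe]
    constructor
    · rintro ⟨i, rfl⟩
      rw [hf i]
      exact ((hrange (y i)).1 ⟨i, rfl⟩).2
    · intro hj
      obtain ⟨i, hi⟩ := (hrange (x j)).2 ⟨⟨j, rfl⟩, hj⟩
      exact ⟨i, hx.1 (by rw [hf i, hi])⟩
  have hcardS : S.card = n := by
    rw [← hmapS, Finset.card_map, Finset.card_univ, Fintype.card_fin]
  have hEy : ∑ i ∈ S, ∑ k ∈ S, lennardJones (dist (x i) (x k)) =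
      2 * interactionEnergy lennardJones y := by
    rw [← hmapS, sum_sum_map_eq_two_mul_interactionEnergy lennardJones lennardJones_zero x fe,
      show (x ∘ fe : Fin n → E3) = y from
        funext fun i => by simp only [Function.comp_apply, hfe, hf]]
  -- (2) the exterior configuration `x|Sᶜ`, all of it farther than `R` from `c`
  set g : Fin Sᶜ.card ↪o Fin N := Sᶜ.orderEmbOfFin rfl with hg
  have hmapSc : Finset.univ.map g.toEmbedding = Sᶜ := Finset.map_orderEmbOfFin_univ Sᶜ rfl
  have hExo := sum_sum_map_eq_two_mul_interactionEnergy lennardJones lennardJones_zero x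
    g.toEmbedding
  rw [hmapSc] at hExo
  have hout : ∀ k, R < dist ((x ∘ g.toEmbedding) k) c := fun k => by
    have hk : g k ∈ Sᶜ := Finset.orderEmbOfFin_mem Sᶜ rfl k
    exact not_le.1 fun h' => Finset.mem_compl.1 hk ((hSiff _).2 h')
  -- (3) decomposition of `2 E(x)` along `S`
  have hdec := two_mul_interactionEnergy_eq_sum_sum lennardJones lennardJones_zero x
  have hsymm : ∑ i ∈ Sᶜ, ∑ k ∈ S, lennardJones (dist (x i) (x k)) =
      ∑ i ∈ S, ∑ k ∈ Sᶜ, lennardJones (dist (x i) (x k)) := by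
    rw [Finset.sum_comm]
    exact Finset.sum_congr rfl fun i _ => Finset.sum_congr rfl fun k _ => by rw [dist_comm]
  rw [sum_sum_eq_add_compl _ S, hEy, hExo, hsymm] at hdec
  -- (4) the competitor `x|Sᶜ ++ y'`: `#Sᶜ + n' ≤ N` distinct points, cross distances `≥ 1`
  have hfar : ∀ k i, 1 ≤ dist ((x ∘ g.toEmbedding) k) (y' i) := fun k i => by
    linarith [hout k, hy'R i, dist_triangle ((x ∘ g.toEmbedding) k) (y' i) c]
  have hne : ∀ k i, (x ∘ g.toEmbedding) k ≠ y' i := fun k i h => by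
    have := hfar k i
    rw [h, dist_self] at this
    norm_num at this
  have hwinj : Function.Injective (Fin.append (x ∘ g.toEmbedding) y') :=
    Fin.append_injective_iff.2 ⟨hx.1.comp g.toEmbedding.injective, hy', hne⟩
  have hK : Sᶜ.card + n' ≤ N := by
    have := Finset.card_add_card_compl S
    rw [Fintype.card_fin] at this
    omega
  have hmin := groundStateEnergy_le_interactionEnergy_of_le (by norm_num : 0 < 3) hK hwinj
  rw [interactionEnergy_append lennardJones lennardJones_zero] at hmin
  have hcross0 : ∑ k, ∑ i, lennardJones
      (dist ((x ∘ g.toEmbedding) k) (y' i)) ≤ 0 :=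
    Finset.sum_nonpos fun k _ => Finset.sum_nonpos fun i _ => lennardJones_nonpos (hfar k i)
  -- (5) the cross term is bounded below by the surface term
  have hc1 : -((1 / 6) * ∑ i ∈ S, ∑ k ∈ Sᶜ, (dist (x i) (x k))⁻¹ ^ 6) ≤
      ∑ i ∈ S, ∑ k ∈ Sᶜ, lennardJones (dist (x i) (x k)) := by
    rw [Finset.mul_sum, ← Finset.sum_neg_distrib]
    refine Finset.sum_le_sum fun i _ => ?_
    rw [Finset.mul_sum, ← Finset.sum_neg_distrib]
    exact Finset.sum_le_sum fun k _ => neg_inv_pow_six_le_lennardJones _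
  have hxE : interactionEnergy lennardJones x = groundStateEnergy lennardJones 3 N := hx.2
  linarith

end Summit.AtomisticToContinuum.Crystallization.Theorems.ExcessDecayLiouvilleFineGrains

end
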